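import Literature.Analysis.FluidPDE.PlanarGraphBandKinematics
import Literature.Analysis.FluidPDE.PlanarStreamGluing
import HarnessLib

/-!
# The shear element: a graph band with rigidly sliding material (births of corners, translations)

Topic `Literature/Analysis/FluidPDE`. Element file of the explicit pullback calculus for the
planar transport equation. The **shear element** is the graph band of
`PlanarGraphBandKinematics.lean` with the RIGID material map `Ξ(t, u) = u + m(t)` (the material
slides along the band at the uniform rate `-m'(t)`; `Ξₓ = 1`) and an arbitrary smooth graph
`v = T(t, u)`:

* `shearScalar Gr T t z = Gr (z₁ - T(t, z₀))`;
* `shearVelocity T Tt Tx m' t z = (-m', Tₜ - Tₓ m')`;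
* `shearStream T P m' c t z = -m' (z₁ - T) - P + c(t)`, `∂ᵤP = Tₜ`, with the free additive `c(t)`.

It realises the BIRTH of a jog on a straight piece (`T(t,u) = y₀ + a(t) J(u)` with a jog profile
`J` of `SmoothRampProfiles.lean`), and the rigid translations / slides of straight pieces. Proved:
transport (`transport_shearScalar`), `shearVelocity = ∇⊥ shearStream`, joint smoothness, the band
lemma, the bound, and the static case.

Folklore; no named facts. Infrastructure towards a discharge of `acm_compatible_blocks`
(`QuasiSelfSimilarCompatibleBlocks.lean`).

## References

* G. Alberti, G. Crippa, A. L. Mazzucato, *Exponential self-similar mixing by incompressible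
  flows*, J. Amer. Math. Soc. 32 (2019), 445–490, §7 (arXiv:1605.02090).
-/

noncomputable section

open Function Set Filter
open scoped Topology ContDiff

namespace Literature.Analysis.FluidPDE

namespace PlanarKinematics

/-- The plane `ℝ²` as a Euclidean space. [folklore] -/
local notation "E²" => EuclideanSpace ℝ (Fin 2)

variable {G : Type*} [NormedAddCommGroup G] [NormedSpace ℝ G]

/-! ## Definitions -/

/-- **Shear element, scalar**: `Θ(t, z) = Gr (z₁ - T(t, z₀))`. [folklore] -/
def shearScalar (Gr : ℝ → G) (T : ℝ → ℝ → ℝ) (t : ℝ) (z : E²) : G := Gr (z 1 - T t (z 0))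

/-- **Shear element, velocity**: `V = (-m', Tₜ - Tₓ m')` (graph-band velocity with the uniform
rate `g = -m'`, `gₓ = 0`). [folklore] -/
def shearVelocity (T Tt Tx : ℝ → ℝ → ℝ) (m' : ℝ → ℝ) (t : ℝ) (z : E²) : E² :=
  graphVelocity (fun s _ => -m' s) (fun _ _ => 0) T Tt Tx t z

/-- **Shear element, stream function**: `H = -m' (z₁ - T) - P + c`, `∂ᵤP = Tₜ`. [folklore] -/
def shearStream (T P : ℝ → ℝ → ℝ) (m' c : ℝ → ℝ) (t : ℝ) (z : E²) : ℝ :=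
  graphStream (fun s _ => -m' s) T P t z + c t

omit [NormedAddCommGroup G] [NormedSpace ℝ G] in
/-- Unfolding the shear scalar. [folklore] -/
theorem shearScalar_apply (Gr : ℝ → G) (T : ℝ → ℝ → ℝ) (t : ℝ) (z : E²) :
    shearScalar Gr T t z = Gr (z 1 - T t (z 0)) := rfl

omit [NormedAddCommGroup G] [NormedSpace ℝ G] in
/-- The shear scalar is the profile `w ↦ Gr w₁` carried by the graph-band pullback with the rigid
material map `Ξ(t,u) = u + m(t)`, `Ξₓ = 1`. [folklore] -/
theorem shearScalar_eq_comp_graphPullback (Gr : ℝ → G) (T : ℝ → ℝ → ℝ) (m : ℝ → ℝ) (t : ℝ) (z : E²) :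
    shearScalar Gr T t z =
      (fun w : E² => Gr (w 1)) (graphPullback T (fun s u => u + m s) (fun _ _ => 1) t z) := by
  simp only [shearScalar, graphPullback_apply, vec2_apply_one, div_one]

/-- Unfolding the shear velocity. [folklore] -/
theorem shearVelocity_apply (T Tt Tx : ℝ → ℝ → ℝ) (m' : ℝ → ℝ) (t : ℝ) (z : E²) :
    shearVelocity T Tt Tx m' t z = vec2 (-m' t) (Tt t (z 0) - Tx t (z 0) * m' t) := by
  rw [shearVelocity, graphVelocity_apply, vec2_eq_vec2_iff]
  exact ⟨rfl, by ring⟩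

/-- Unfolding the shear stream function. [folklore] -/
theorem shearStream_apply (T P : ℝ → ℝ → ℝ) (m' c : ℝ → ℝ) (t : ℝ) (z : E²) :
    shearStream T P m' c t z = -m' t * (z 1 - T t (z 0)) - P t (z 0) + c t := by
  rw [shearStream, graphStream_apply]

/-- The rigid material map has Eulerian rate `-m'`. [folklore] -/
theorem axialRate_rigid (m' : ℝ → ℝ) (t x : ℝ) :
    axialRate (fun _ _ => (1 : ℝ)) (fun s _ => m' s) t x = -m' t := by
  simp [axialRate]

/-- The rigid material map has vanishing rate derivative. [folklore] -/
theorem axialRateDeriv_rigid (m' : ℝ → ℝ) (t x : ℝ) :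
    axialRateDeriv (fun _ _ => (1 : ℝ)) (fun s _ => m' s) (fun _ _ => 0) (fun _ _ => 0) t x = 0 := by
  simp [axialRateDeriv]

/-! ## Transport and stream function -/

/-- **The shear element is transported** by its velocity wherever the data are differentiable.
[folklore] -/
theorem transport_shearScalar {Gr : ℝ → G} {T Tt Tx : ℝ → ℝ → ℝ} {m : ℝ → ℝ} {m't : ℝ} {t : ℝ} {z : E²}
    (hG : DifferentiableAt ℝ Gr (z 1 - T t (z 0)))
    (hT : HasDerivAt (fun s => T s (z 0)) (Tt t (z 0)) t) (hTx : HasDerivAt (T t) (Tx t (z 0)) (z 0))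
    (hm : HasDerivAt m m't t) (m' : ℝ → ℝ) (hm' : m' t = m't) :
    deriv (fun s => shearScalar Gr T s z) t +
      fderiv ℝ (shearScalar Gr T t) z (shearVelocity T Tt Tx m' t z) = 0 := by
  set Ξ : ℝ → ℝ → ℝ := fun s u => u + m s with hΞ
  have hproj : DifferentiableAt ℝ (fun w : E² => Gr (w 1)) (graphPullback T Ξ (fun _ _ => 1) t z) := by
    have h1 : DifferentiableAt ℝ (fun w : E² => w 1) (graphPullback T Ξ (fun _ _ => 1) t z) :=
      (EuclideanSpace.proj (1 : Fin 2) : E² →L[ℝ] ℝ).differentiableAt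
    refine DifferentiableAt.comp (graphPullback T Ξ (fun _ _ => 1) t z) ?_ h1
    simpa only [graphPullback_apply, vec2_apply_one, div_one] using hG
  have ht : HasDerivAt (fun s => Ξ s (z 0)) ((fun s (_ : ℝ) => m' s) t (z 0)) t := by
    simpa only [hΞ, hm'] using hm.const_add (z 0)
  have hx : HasDerivAt (Ξ t) ((fun (_ : ℝ) (_ : ℝ) => (1 : ℝ)) t (z 0)) (z 0) :=
    (hasDerivAt_id' (z 0)).add_const (m t)
  have hxx : HasDerivAt ((fun (_ : ℝ) (_ : ℝ) => (1 : ℝ)) t) ((fun (_ : ℝ) (_ : ℝ) => (0 : ℝ)) t (z 0)) (z 0) :=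
    hasDerivAt_const _ _
  have hxt : HasDerivAt (fun s => (fun (_ : ℝ) (_ : ℝ) => (1 : ℝ)) s (z 0))
      ((fun (_ : ℝ) (_ : ℝ) => (0 : ℝ)) t (z 0)) t := hasDerivAt_const _ _
  have h := transport_comp_graphPullback (Θ := fun w : E² => Gr (w 1)) (T := T) (Tt := Tt) (Tx := Tx) (Ξ := Ξ)
    (Ξx := fun _ _ => 1) (Ξt := fun s _ => m' s) (Ξxx := fun _ _ => 0) (Ξxt := fun _ _ => 0)
    hproj hT hTx ht hx hxx hxt one_ne_zero
  have e1 : (fun s => (fun w : E² => Gr (w 1)) (graphPullback T Ξ (fun _ _ => 1) s z)) =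
      fun s => shearScalar Gr T s z := by
    funext s; exact (shearScalar_eq_comp_graphPullback Gr T m s z).symm
  have e2 : (fun w => (fun w : E² => Gr (w 1)) (graphPullback T Ξ (fun _ _ => 1) t w)) = shearScalar Gr T t := by
    funext w; exact (shearScalar_eq_comp_graphPullback Gr T m t w).symm
  have e3 : graphVelocity (axialRate (fun _ _ => (1 : ℝ)) (fun s _ => m' s))
      (axialRateDeriv (fun _ _ => (1 : ℝ)) (fun s _ => m' s) (fun _ _ => 0) (fun _ _ => 0)) T Tt Tx t z =
      shearVelocity T Tt Tx m' t z := by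
    rw [graphVelocity_apply, shearVelocity, graphVelocity_apply, axialRate_rigid, axialRateDeriv_rigid]
  rw [e1, e2, e3] at h
  exact h

/-- **The shear velocity is the perpendicular gradient of the shear stream function**, provided
`∂ᵤP(t,·) = Tₜ(t,·)` at the point. [folklore] -/
theorem shearVelocity_eq_perpGrad_shearStream {T Tt Tx P : ℝ → ℝ → ℝ} {m' c : ℝ → ℝ} {t : ℝ} {z : E²}
    (hT : HasDerivAt (T t) (Tx t (z 0)) (z 0)) (hP : HasDerivAt (P t) (Tt t (z 0)) (z 0)) :
    shearVelocity T Tt Tx m' t z = perpGrad (shearStream T P m' c t) z := by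
  have hg : HasDerivAt ((fun s (_ : ℝ) => -m' s) t) ((fun (_ : ℝ) (_ : ℝ) => (0 : ℝ)) t (z 0)) (z 0) :=
    hasDerivAt_const _ _
  have h := graphVelocity_eq_perp_fderiv_graphStream (g := fun s _ => -m' s) (gx := fun _ _ => (0 : ℝ)) (T := T)
    (Tt := Tt) (Tx := Tx) (P := P) hg hT hP
  have e : shearStream T P m' c t = fun w => graphStream (fun s _ => -m' s) T P t w + c t := rfl
  rw [shearVelocity, h, e]
  simp only [perpGrad_apply, fderiv_add_const]

/-! ## Smoothness -/

/-- **The shear scalar is smooth** when `Gr` and `T` are. [folklore] -/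
theorem contDiff_uncurry_shearScalar {Gr : ℝ → G} {T : ℝ → ℝ → ℝ} (hGr : ContDiff ℝ ∞ Gr)
    (hT : ContDiff ℝ ∞ (uncurry T)) : ContDiff ℝ ∞ (uncurry (shearScalar Gr T)) := by
  have h0 : ContDiff ℝ ∞ fun p : ℝ × E² => p.2 0 := (contDiff_coord 0).comp contDiff_snd
  have h1 : ContDiff ℝ ∞ fun p : ℝ × E² => p.2 1 := (contDiff_coord 1).comp contDiff_snd
  have e : uncurry (shearScalar Gr T) = fun p : ℝ × E² => Gr (p.2 1 - T p.1 (p.2 0)) := by funext p; rfl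
  rw [e]
  exact hGr.comp (h1.sub (hT.comp (contDiff_fst.prodMk h0)))

/-- **The shear velocity is smooth.** [folklore] -/
theorem contDiff_uncurry_shearVelocity {T Tt Tx : ℝ → ℝ → ℝ} {m' : ℝ → ℝ} (hT : ContDiff ℝ ∞ (uncurry T))
    (hTt : ContDiff ℝ ∞ (uncurry Tt)) (hTx : ContDiff ℝ ∞ (uncurry Tx)) (hm' : ContDiff ℝ ∞ m') :
    ContDiff ℝ ∞ (uncurry (shearVelocity T Tt Tx m')) :=
  contDiff_uncurry_graphVelocity (g := fun s _ => -m' s) (gx := fun _ _ => (0 : ℝ)) (T := T) (Tt := Tt) (Tx := Tx)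
    ((hm'.comp contDiff_fst).neg) contDiff_const hT hTt hTx

/-- **The shear stream function is smooth.** [folklore] -/
theorem contDiff_uncurry_shearStream {T P : ℝ → ℝ → ℝ} {m' c : ℝ → ℝ} (hT : ContDiff ℝ ∞ (uncurry T))
    (hP : ContDiff ℝ ∞ (uncurry P)) (hm' : ContDiff ℝ ∞ m') (hc : ContDiff ℝ ∞ c) :
    ContDiff ℝ ∞ (uncurry (shearStream T P m' c)) := by
  have h := contDiff_uncurry_graphStream (g := fun s _ => -m' s) (T := T) (P := P)
    ((hm'.comp contDiff_fst).neg) hT hP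
  have e : uncurry (shearStream T P m' c) = fun p : ℝ × E² =>
      uncurry (graphStream (fun s _ => -m' s) T P) p + c p.1 := by
    funext p; rfl
  rw [e]
  exact h.add (hc.comp contDiff_fst)

/-! ## The band, the bound, the static case -/

omit [NormedSpace ℝ G] in
/-- **Band lemma**: if the profile vanishes off `(-r, r)`, a point where the shear scalar does not
vanish satisfies `|z₁ - T(t, z₀)| < r`. [folklore] -/
theorem abs_sub_lt_of_shearScalar_ne_zero {Gr : ℝ → G} {T : ℝ → ℝ → ℝ} {r : ℝ} {t : ℝ} {z : E²}
    (hGr : ∀ q, Gr q ≠ 0 → |q| < r) (hne : shearScalar Gr T t z ≠ 0) : |z 1 - T t (z 0)| < r :=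
  hGr _ hne

/-- **Bound, real profile**: `|shearScalar| ≤ M` when `|Gr| ≤ M`. [folklore] -/
theorem abs_shearScalar_le {Gr : ℝ → ℝ} {T : ℝ → ℝ → ℝ} {M : ℝ} (hM : ∀ q, |Gr q| ≤ M) (t : ℝ) (z : E²) :
    |shearScalar Gr T t z| ≤ M := hM _

/-- **Static case**: where `m'(t) = 0` and `Tₜ(t, z₀) = 0` the shear velocity vanishes. [folklore] -/
theorem shearVelocity_eq_zero_of_static {T Tt Tx : ℝ → ℝ → ℝ} {m' : ℝ → ℝ} {t : ℝ} {z : E²}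
    (hm : m' t = 0) (hTt : Tt t (z 0) = 0) : shearVelocity T Tt Tx m' t z = 0 := by
  rw [shearVelocity_apply, hm, hTt]
  simp [vec2_eq_zero_iff]

/-- **Pure translation**: where `Tₓ(t, z₀) = 0`… more useful: with `m' = 0` (no slide) the shear
velocity is vertical, `(0, Tₜ)`. [folklore] -/
theorem shearVelocity_of_no_slide {T Tt Tx : ℝ → ℝ → ℝ} {m' : ℝ → ℝ} {t : ℝ} {z : E²} (hm : m' t = 0) :
    shearVelocity T Tt Tx m' t z = vec2 0 (Tt t (z 0)) := by
  rw [shearVelocity_apply, hm, vec2_eq_vec2_iff]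
  constructor <;> ring

end PlanarKinematics

end Literature.Analysis.FluidPDE
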